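import Literature.NumberTheory.LFunctions.KMVFirstMomentBeyondDiagonal
import Literature.NumberTheory.LFunctions.MoebiusLogHarmonicSum
import Literature.NumberTheory.LFunctions.SiegelWalfiszLiouville
import Mathlib.NumberTheory.EulerProduct.Basic
import Mathlib.NumberTheory.ZetaValues
import HarnessLib

/-!
# The diagonal main term of the first mollified moment:
# `Σ_{m ≤ M} μ(m)ψ(m)⁻¹m⁻¹ P(log(M/m)/log M) = ζ(2)P′(1)/log M + O_P(log⁻² M)`, PROVED —
# and S1 of route `PrimeLevelFamEdge` from Bettin's theorem alone

Topic `Literature/NumberTheory/LFunctions` (cell landau-siegel, family B-fam; Part 2 of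
`KMVFirstMomentBeyondDiagonal`). Everything in this file is PROVED (no named fact). It discharges
the displayed hypothesis `KMV2000.MollifierMainTermAsymp P` of `KMVFirstMomentBeyondDiagonal` for
every admissible profile `P` (`P(0) = P′(0) = 0`), i.e. the main-term evaluation that
Kowalski–Michel–VanderKam perform by residues in §4.1 [held: paper:doi-10-1515-crll-2000-074
p0010–p0012: (16) the `m`-sum `Σ_m μ(m)ψ(m)⁻¹ m⁻¹ (log q̂/m)^k P(log(M/m)/log M) V(m/q̂)`, (18) its
Dirichlet-series factorisation `η₁(s,t,z)/ζ(1+s+t+z)` with `η₁(0,0,0) = ζ(2)`, (19)–(20) the total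
residue `ζ(2)q̂^{1/2}(log q̂)^k(P′(1)/log M + …)`], at `k = 0` and `V ≡ 1`, from the prime number
/-- Helper. [folklore] -/
theorem for `μ` with de la Vallée-Poussin remainder as it stands PROVED in the tree:
`abs_sum_moebius_div_le_exp_neg_sqrt_log` (`Σ_{n≤x} μ(n)/n ≪ e^{−c√log x}`, `MoebiusHarmonicSumBound`),
`abs_sum_moebius_mul_log_div_add_one_le` (`Σ_{n≤x} μ(n)log n/n = −1 + O(e^{−c√log x})`,
`MoebiusLogHarmonicSum`, through Green–Tao's `M₁(x) → 1`).

PROOF ARCHITECTURE (real variables; Montgomery–Vaughan §8.1 for the Möbius sums).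
* §7 `μ(m)/(mψ(m)) = ((μ/id) ∗ h)(m)` with `h(n) = n⁻¹∏_{p∣n}(p+1)⁻¹` (`h(p^a) = p^{−a}/(p+1)`):
  both sides multiplicative arithmetic functions agreeing at prime powers (`W_eq_G_mul_Hh`).
* §8 `h ≥ 0` is summable with `Σ h(n) log n < ∞` (every `n = b²a`, `a` squarefree, has
  `h(n) ≤ a⁻²b⁻²`) and `Σ h(n) = ∏_p (1 − p⁻²)⁻¹ = ζ(2) = π²/6` (`hasSum_Hh`; Mathlib's Euler
  products and `hasSum_zeta_two`).
* §9 `Σ_{d≤N} μ(d) logⁱd/d = O_i(1)` for `i ≥ 2` (`abs_moebiusLogPowSum_le`: Abel summation from the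
  `i = 1` sum, `e^{−c√log n} logⁱ⁻²(n+1)/n ≪ 1/(n log²n)`, telescoped).
* §10 the Riesz means `R_j(y) = Σ_{d≤y} μ(d)/d·logʲ(y/d) = j log^{j−1}y + O_j(1 + log^{j−2}y)`
  uniformly in `y ≥ 1` (`abs_moebiusRiesz_sub_le`: binomial expansion).
* §11 `W_j(M) = Σ_{m≤M} μ(m)/(mψ(m)) logʲ(M/m) = Σ_{n≤M} h(n)R_j(M/n) = ζ(2)·j·log^{j−1}M + O_j(log^{j−2}M)`
  (`abs_weightLogPowSum_sub_le`; the tail `Σ_{n>M} h(n) ≤ (Σ h(n)log n)/log M`).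
* §12 `KMV2000.mollifierMainTermAsymp_of_admissible` — `S_P(M) = Σ_j a_j (log M)^{−j} W_j(M)`,
  `P′(1) = Σ j a_j`, `a₀ = a₁ = 0` — and the corollaries with Bettin's printed theorem as the ONLY
  hypothesis: `KMV2000.firstDisplay_of_bettin'` (first KMV display with zero extra main term at
  `Q = 1`, `0 < Δ' < 2`, every admissible `P`), `KMV2000.T₁_apply_one_eq_zero_of_bettin`, and
  `KMV2000.firstCorrectionVanishes_of_bettin_X_sq` = the route stub S1 in its corrected form
  (`Δ' < min Δ 2`), GIVEN ONLY `bettin2017_theorem11_primeLevel`.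

WHAT THIS IS NOT: no claim about the second moment, `BeyondDiagonalBeatsQuarter`, or Landau–Siegel
zeros. «The programme SEARCHES and TYPES; no claim about Landau–Siegel zeros, Theorems 1–2 of
arXiv:2211.02515 or a repaired Margin232 until a kernel theorem says so.»

## References

* [KowalskiMichelVanderKam2000] E. Kowalski, P. Michel, J. VanderKam, J. reine angew. Math. 526
  (2000) 1–34 — §4 (16), (18), §4.1 (19)–(20), §4.2, Prop. 4.1.
  [held: paper:doi-10-1515-crll-2000-074 p0010–p0012]
* [MontgomeryVaughan2007] H. L. Montgomery, R. C. Vaughan, *Multiplicative Number Theory I*, CUP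
  2007, §8.1 (8.6)–(8.8) (`Σ μ(n)/n = 0`, `Σ μ(n) log n/n = −1`; the tree's inputs).
* [Bettin2017] S. Bettin, Funct. Approx. Comment. Math. 57 (2017), Thm. 1.1 (the printed hypothesis
  of the corollaries). [held: paper:arxiv-1605.02440 p0003–p0005]
-/

noncomputable section

open scoped Real ArithmeticFunction.Moebius
open Finset Polynomial ArithmeticFunction

namespace Literature.NumberTheory.LFunctions

namespace KMV2000

namespace MollifierMainTerm

/-! ## §7. The weight `μ(m)/(mψ(m))` as a Dirichlet convolution `(μ/id) ∗ h` -/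

/-- `n ↦ n⁻¹` as an arithmetic function (completely multiplicative). [folklore] -/
def invA : ArithmeticFunction ℝ := ⟨fun n ↦ (n : ℝ)⁻¹, by simp⟩

/-- Unfolding `invA`. [folklore] -/
@[simp] private theorem invA_apply (n : ℕ) : invA n = (n : ℝ)⁻¹ := rfl

/-- `n ↦ n⁻¹` is multiplicative. [folklore] -/
private theorem isMultiplicative_invA : IsMultiplicative invA := by
  refine ⟨by simp, fun {m n} _ ↦ ?_⟩
  simp [mul_comm]

/-- `G(d) = μ(d)/d`. [folklore] -/
def G : ArithmeticFunction ℝ := (μ : ArithmeticFunction ℝ).pmul invA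

/-- Unfolding `G(d) = μ(d)/d`. [folklore] -/
@[simp] private theorem G_apply (n : ℕ) : G n = (μ n : ℝ) * (n : ℝ)⁻¹ := by
  simp [G, pmul_apply, intCoe_apply]

/-- `μ/id` is multiplicative. [folklore] -/
private theorem isMultiplicative_G : IsMultiplicative G :=
  isMultiplicative_moebius.intCast.pmul isMultiplicative_invA

/-- `h(n) = n⁻¹ ∏_{p ∣ n} (p+1)⁻¹` (so `h(p^a) = p^{−a}/(p+1)`). [folklore] -/
def Hh : ArithmeticFunction ℝ := invA.pmul (prodPrimeFactors fun p ↦ ((p : ℝ) + 1)⁻¹)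

/-- `h` is multiplicative. [folklore] -/
private theorem isMultiplicative_Hh : IsMultiplicative Hh :=
  isMultiplicative_invA.pmul (IsMultiplicative.prodPrimeFactors _)

/-- Unfolding `h(n) = n⁻¹∏_{p∣n}(p+1)⁻¹` for `n ≠ 0`. [folklore] -/
private theorem Hh_apply {n : ℕ} (hn : n ≠ 0) :
    Hh n = (n : ℝ)⁻¹ * ∏ p ∈ n.primeFactors, ((p : ℝ) + 1)⁻¹ := by
  simp [Hh, pmul_apply, prodPrimeFactors_apply hn]

/-- `h ≥ 0`. [folklore] -/
private theorem Hh_nonneg (n : ℕ) : 0 ≤ Hh n := by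
  rcases eq_or_ne n 0 with rfl | hn
  · simp
  rw [Hh_apply hn]
  exact mul_nonneg (by positivity) (Finset.prod_nonneg fun p _ ↦ by positivity)

/-- `W(m) = μ(m) m⁻¹ ∏_{p ∣ m}(1 + p⁻¹)⁻¹ = μ(m)/(m ψ(m))`. [folklore] -/
def W : ArithmeticFunction ℝ :=
  ((μ : ArithmeticFunction ℝ).pmul invA).pmul (prodPrimeFactors fun p ↦ (1 + (p : ℝ)⁻¹)⁻¹)

/-- `μ/(id·ψ)` is multiplicative. [folklore] -/
private theorem isMultiplicative_W : IsMultiplicative W :=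
  (isMultiplicative_moebius.intCast.pmul isMultiplicative_invA).pmul
    (IsMultiplicative.prodPrimeFactors _)

/-- Unfolding `W(m) = μ(m)ψ(m)⁻¹m⁻¹` for `m ≠ 0`. [folklore] -/
private theorem W_apply {m : ℕ} (hm : m ≠ 0) :
    W m = (μ m : ℝ) * ((psi m)⁻¹ * (m : ℝ)⁻¹) := by
  simp only [W, pmul_apply, intCoe_apply, invA_apply, prodPrimeFactors_apply hm, psi,
    Finset.prod_inv_distrib]
  ring

/-! ### values at prime powers -/

/-- `∏ᵖ_{q ∣ p^i} f(q) = f(p)` for `i ≥ 1`. [folklore] -/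
private theorem prodPrimeFactors_apply_prime_pow (f : ℕ → ℝ) {p i : ℕ} (hp : p.Prime) (hi : i ≠ 0) :
    prodPrimeFactors f (p ^ i) = f p := by
  rw [prodPrimeFactors_apply (pow_ne_zero _ hp.ne_zero), Nat.primeFactors_prime_pow hi hp,
    Finset.prod_singleton]

/-- `h(p^i) = p^{−i}(p+1)⁻¹` for `i ≥ 1`. [folklore] -/
private theorem Hh_apply_prime_pow {p i : ℕ} (hp : p.Prime) (hi : i ≠ 0) :
    Hh (p ^ i) = ((p : ℝ) ^ i)⁻¹ * ((p : ℝ) + 1)⁻¹ := by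
  simp only [Hh, pmul_apply, invA_apply, prodPrimeFactors_apply_prime_pow _ hp hi]
  push_cast
  ring

/-- `G(p) = −1/p`. [folklore] -/
private theorem G_apply_prime {p : ℕ} (hp : p.Prime) : G p = -(p : ℝ)⁻¹ := by
  rw [G_apply, ArithmeticFunction.moebius_apply_prime hp]
  push_cast
  ring

/-- `G(p^i) = 0` for `i ≥ 2`. [folklore] -/
private theorem G_apply_prime_pow_of_two_le {p i : ℕ} (hp : p.Prime) (hi : 2 ≤ i) : G (p ^ i) = 0 := by
  rw [G_apply, ArithmeticFunction.moebius_apply_prime_pow hp (by omega), if_neg (by omega)]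
  simp

/-- `W(p) = −1/(p+1)`, `W(p^i) = 0` for `i ≥ 2`. [folklore] -/
private theorem W_apply_prime_pow {p i : ℕ} (hp : p.Prime) (hi : i ≠ 0) :
    W (p ^ i) = if i = 1 then -((p : ℝ) + 1)⁻¹ else 0 := by
  simp only [W, pmul_apply, intCoe_apply, invA_apply, prodPrimeFactors_apply_prime_pow _ hp hi,
    ArithmeticFunction.moebius_apply_prime_pow hp hi]
  have hp0 : (p : ℝ) ≠ 0 := by exact_mod_cast hp.ne_zero
  split_ifs with h
  · subst h
    push_cast
    field_simp
  · simp

/-- `(G ∗ h)(p^i) = h(p^i) + G(p) h(p^{i−1})` for `i ≥ 1` (the terms `G(p^j)`, `j ≥ 2`, vanish).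
[folklore] -/
private theorem G_mul_Hh_apply_prime_pow {p k : ℕ} (hp : p.Prime) :
    (G * Hh) (p ^ (k + 1)) = Hh (p ^ (k + 1)) + G p * Hh (p ^ k) := by
  rw [mul_apply, Nat.sum_divisorsAntidiagonal fun a b ↦ G a * Hh b, Nat.divisors_prime_pow hp,
    Finset.sum_map]
  simp only [Function.Embedding.coeFn_mk]
  have hdiv : ∀ j ∈ Finset.range (k + 1 + 1), p ^ (k + 1) / p ^ j = p ^ (k + 1 - j) :=
    fun j hj ↦ Nat.pow_div (by simpa [Nat.lt_succ_iff] using hj) hp.pos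
  rw [Finset.sum_congr rfl fun j hj ↦ by rw [hdiv j hj], Finset.sum_range_succ', Finset.sum_range_succ']
  have hrest : ∑ j ∈ Finset.range k, G (p ^ (j + 1 + 1)) * Hh (p ^ (k + 1 - (j + 1 + 1))) = 0 :=
    Finset.sum_eq_zero fun j _ ↦ by rw [G_apply_prime_pow_of_two_le hp (by omega), zero_mul]
  rw [hrest, zero_add, pow_zero, pow_one, isMultiplicative_G.map_one, one_mul]
  have e1 : k + 1 - (0 + 1) = k := by omega
  have e2 : k + 1 - 0 = k + 1 := by omega
  rw [e1, e2, add_comm]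

/-- **`μ(m)/(mψ(m)) = ((μ/id) ∗ h)(m)`**: both sides are multiplicative and agree at prime powers
(the factorisation `Σ_m μ(m)ψ(m)⁻¹m^{−1−s} = η₁(s)/ζ(1+s)` of KMV (18), `η₁ = Σ h(n)n^{−s}`).
[cite: KowalskiMichelVanderKam2000, §4 (18)] -/
theorem W_eq_G_mul_Hh : W = G * Hh := by
  rw [IsMultiplicative.eq_iff_eq_on_prime_powers _ isMultiplicative_W _
    (isMultiplicative_G.mul isMultiplicative_Hh)]
  intro p i hp
  rcases Nat.eq_zero_or_pos i with rfl | hi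
  · rw [pow_zero, isMultiplicative_W.map_one, (isMultiplicative_G.mul isMultiplicative_Hh).map_one]
  obtain ⟨k, rfl⟩ : ∃ k, i = k + 1 := ⟨i - 1, by omega⟩
  rw [W_apply_prime_pow hp (by omega), G_mul_Hh_apply_prime_pow hp, G_apply_prime hp]
  have hp0 : (p : ℝ) ≠ 0 := by exact_mod_cast hp.ne_zero
  have hp1 : (p : ℝ) + 1 ≠ 0 := by positivity
  rcases Nat.eq_zero_or_pos k with rfl | hk
  · simp only [zero_add, if_true, pow_zero, isMultiplicative_Hh.map_one, mul_one]
    rw [Hh_apply_prime_pow hp one_ne_zero, pow_one]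
    field_simp
    ring
  · rw [if_neg (by omega), Hh_apply_prime_pow hp (by omega), Hh_apply_prime_pow hp (by omega)]
    rw [pow_succ]
    field_simp
    ring

/-! ## §8. `h ≥ 0` is summable, `Σ h(n) log n < ∞`, and `Σ h(n) = ζ(2) = π²/6` -/

/-- A summability criterion: `0 ≤ f(n) ≤ u(a_n) v(b_n)` with `n ↦ (a_n, b_n)` injective on `n ≥ 1`
and `u, v ≥ 0` summable. [folklore] -/
private theorem summable_of_le_mul_of_injOn {f u v : ℕ → ℝ} (hf : ∀ n, 0 ≤ f n) (hf0 : f 0 = 0)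
    (hu : ∀ n, 0 ≤ u n) (hv : ∀ n, 0 ≤ v n) (hus : Summable u) (hvs : Summable v)
    (φ : ℕ → ℕ × ℕ) (hφ : Set.InjOn φ {n | 0 < n})
    (hle : ∀ n, 0 < n → f n ≤ u (φ n).1 * v (φ n).2) : Summable f := by
  classical
  refine summable_of_sum_range_le hf (c := (∑' n, u n) * ∑' n, v n) fun N ↦ ?_
  have hsplit : ∑ i ∈ Finset.range N, f i = ∑ i ∈ (Finset.range N).filter (0 < ·), f i := by
    rw [Finset.sum_filter]
    refine Finset.sum_congr rfl fun i _ ↦ ?_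
    split_ifs with h
    · rfl
    · have : i = 0 := by omega
      rw [this, hf0]
  rw [hsplit]
  set S := (Finset.range N).filter (0 < ·) with hS
  have hinj : Set.InjOn φ ↑S := fun a ha b hb h ↦
    hφ (by simpa [hS] using (Finset.mem_filter.1 ha).2) (by simpa [hS] using (Finset.mem_filter.1 hb).2) h
  calc ∑ i ∈ S, f i ≤ ∑ i ∈ S, u (φ i).1 * v (φ i).2 :=
        Finset.sum_le_sum fun i hi ↦ hle i (Finset.mem_filter.1 hi).2
    _ = ∑ x ∈ S.image φ, u x.1 * v x.2 :=
        (Finset.sum_image (f := fun x : ℕ × ℕ ↦ u x.1 * v x.2) hinj).symm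
    _ ≤ ∑ x ∈ (S.image φ).image Prod.fst ×ˢ (S.image φ).image Prod.snd, u x.1 * v x.2 :=
        Finset.sum_le_sum_of_subset_of_nonneg Finset.subset_product
          fun x _ _ ↦ mul_nonneg (hu _) (hv _)
    _ = (∑ a ∈ (S.image φ).image Prod.fst, u a) * ∑ b ∈ (S.image φ).image Prod.snd, v b := by
        rw [Finset.sum_product, Finset.sum_mul_sum]
    _ ≤ (∑' n, u n) * ∑' n, v n := by
        refine mul_le_mul (sum_le_hasSum _ (fun i _ ↦ hu i) hus.hasSum)
          (sum_le_hasSum _ (fun i _ ↦ hv i) hvs.hasSum) (Finset.sum_nonneg fun i _ ↦ hv i)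
          (tsum_nonneg hu)

/-- The square-free kernel data: for `n ≥ 1`, `n = b² a` with `a` squarefree, `a, b ≥ 1`
(junk `(0,0)` at `n = 0`). [folklore] -/
def sqf (n : ℕ) : ℕ × ℕ :=
  if h : 0 < n then
    ((Nat.sq_mul_squarefree_of_pos h).choose,
      (Nat.sq_mul_squarefree_of_pos h).choose_spec.choose)
  else (0, 0)

/-- The defining property of `sqf`. [folklore] -/
private theorem sqf_spec {n : ℕ} (hn : 0 < n) :
    0 < (sqf n).1 ∧ 0 < (sqf n).2 ∧ (sqf n).2 ^ 2 * (sqf n).1 = n ∧ Squarefree (sqf n).1 := by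
  rw [sqf, dif_pos hn]
  exact (Nat.sq_mul_squarefree_of_pos hn).choose_spec.choose_spec

/-- `n ↦ sqf n` is injective on `n ≥ 1` (as `b²a = n`). [folklore] -/
private theorem sqf_injOn : Set.InjOn sqf {n | 0 < n} := by
  intro m hm n hn h
  obtain ⟨-, -, hm3, -⟩ := sqf_spec (show 0 < m from hm)
  obtain ⟨-, -, hn3, -⟩ := sqf_spec (show 0 < n from hn)
  rw [← hm3, ← hn3, h]

/-- `h(n) ≤ a⁻² b⁻²` for `n = b²a`, `a` squarefree (`∏_{p ∣ n}(p+1) ≥ ∏_{p ∣ a} p = a`). [folklore] -/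
private theorem Hh_le_sqf {n : ℕ} (hn : 0 < n) :
    Hh n ≤ (((sqf n).1 : ℝ) ^ 2)⁻¹ * (((sqf n).2 : ℝ) ^ 2)⁻¹ := by
  obtain ⟨ha, hb, hab, hsq⟩ := sqf_spec hn
  set a := (sqf n).1
  set b := (sqf n).2
  have ha0 : (0 : ℝ) < a := by exact_mod_cast ha
  have hb0 : (0 : ℝ) < b := by exact_mod_cast hb
  have hn0 : n ≠ 0 := hn.ne'
  rw [Hh_apply hn0]
  -- `∏_{p ∣ n} (p+1)⁻¹ ≤ ∏_{p ∣ a} (p+1)⁻¹ ≤ ∏_{p ∣ a} p⁻¹ = a⁻¹`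
  have hsub : a.primeFactors ⊆ n.primeFactors :=
    Nat.primeFactors_mono ⟨b ^ 2, by rw [← hab]; ring⟩ hn0
  have h1 : ∏ p ∈ n.primeFactors, ((p : ℝ) + 1)⁻¹ ≤ ∏ p ∈ a.primeFactors, ((p : ℝ) + 1)⁻¹ := by
    rw [← Finset.prod_sdiff hsub]
    refine mul_le_of_le_one_left (Finset.prod_nonneg fun p _ ↦ by positivity) ?_
    exact Finset.prod_le_one (fun p _ ↦ by positivity) fun p _ ↦
      inv_le_one_of_one_le₀ (by linarith [(Nat.cast_nonneg p : (0 : ℝ) ≤ p)])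
  have h2 : ∏ p ∈ a.primeFactors, ((p : ℝ) + 1)⁻¹ ≤ ∏ p ∈ a.primeFactors, (p : ℝ)⁻¹ := by
    refine Finset.prod_le_prod (fun p _ ↦ by positivity) fun p hp ↦ ?_
    have hp0 : (0 : ℝ) < p := by exact_mod_cast (Nat.prime_of_mem_primeFactors hp).pos
    exact inv_anti₀ hp0 (by linarith)
  have h3 : ∏ p ∈ a.primeFactors, (p : ℝ)⁻¹ = (a : ℝ)⁻¹ := by
    rw [Finset.prod_inv_distrib, ← Nat.cast_prod, Nat.prod_primeFactors_of_squarefree hsq]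
  have hn' : (n : ℝ) = (b : ℝ) ^ 2 * a := by rw [← hab]; push_cast; ring
  calc (n : ℝ)⁻¹ * ∏ p ∈ n.primeFactors, ((p : ℝ) + 1)⁻¹
      ≤ (n : ℝ)⁻¹ * (a : ℝ)⁻¹ := by
        refine mul_le_mul_of_nonneg_left ((h1.trans h2).trans h3.le) (by positivity)
    _ = (((a : ℝ)) ^ 2)⁻¹ * (((b : ℝ)) ^ 2)⁻¹ := by
        rw [hn']
        field_simp

/-- `h` is summable. [folklore] -/
private theorem summable_Hh : Summable (fun n ↦ Hh n) := by
  have hs : Summable (fun n : ℕ ↦ ((n : ℝ) ^ 2)⁻¹) := Real.summable_nat_pow_inv.mpr one_lt_two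
  refine summable_of_le_mul_of_injOn Hh_nonneg (by simp) (fun n ↦ by positivity)
    (fun n ↦ by positivity) hs hs sqf sqf_injOn fun n hn ↦ Hh_le_sqf hn

/-- `Σ h(n) log n < ∞` (`log n ≤ 4n^{1/4}` and `n^{1/4} a⁻² b⁻² = a^{−7/4} b^{−3/2}` for `n = b²a`).
[folklore] -/
private theorem summable_Hh_mul_log : Summable (fun n ↦ Hh n * Real.log n) := by
  have hu : Summable (fun n : ℕ ↦ (n : ℝ) ^ (-(7 / 4 : ℝ))) :=
    Real.summable_nat_rpow.mpr (by norm_num)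
  have hv : Summable (fun n : ℕ ↦ 4 * (n : ℝ) ^ (-(3 / 2 : ℝ))) :=
    (Real.summable_nat_rpow.mpr (by norm_num)).mul_left 4
  refine summable_of_le_mul_of_injOn (fun n ↦ ?_) (by simp) (fun n ↦ by positivity)
    (fun n ↦ by positivity) hu hv sqf sqf_injOn fun n hn ↦ ?_
  · rcases Nat.eq_zero_or_pos n with rfl | hn
    · simp
    · exact mul_nonneg (Hh_nonneg n) (Real.log_nonneg (by exact_mod_cast hn))
  obtain ⟨ha, hb, hab, -⟩ := sqf_spec hn
  set a := (sqf n).1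
  set b := (sqf n).2
  have ha0 : (0 : ℝ) < a := by exact_mod_cast ha
  have hb0 : (0 : ℝ) < b := by exact_mod_cast hb
  have hn0 : (0 : ℝ) < n := by exact_mod_cast hn
  have hlog : Real.log n ≤ (n : ℝ) ^ (1 / 4 : ℝ) / (1 / 4) := Real.log_le_rpow_div hn0.le (by norm_num)
  have hn' : (n : ℝ) = (b : ℝ) ^ 2 * a := by rw [← hab]; push_cast; ring
  have hpow : (n : ℝ) ^ (1 / 4 : ℝ) = (b : ℝ) ^ (1 / 2 : ℝ) * (a : ℝ) ^ (1 / 4 : ℝ) := by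
    rw [hn', Real.mul_rpow (by positivity) ha0.le, ← Real.rpow_natCast (b : ℝ) 2,
      ← Real.rpow_mul hb0.le]
    norm_num
  calc Hh n * Real.log n
      ≤ ((((a : ℝ)) ^ 2)⁻¹ * (((b : ℝ)) ^ 2)⁻¹) * ((n : ℝ) ^ (1 / 4 : ℝ) / (1 / 4)) :=
        mul_le_mul (Hh_le_sqf hn) hlog (Real.log_nonneg (by exact_mod_cast hn)) (by positivity)
    _ = (a : ℝ) ^ (-(7 / 4 : ℝ)) * (4 * (b : ℝ) ^ (-(3 / 2 : ℝ))) := by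
        rw [hpow]
        have e1 : (((a : ℝ)) ^ 2)⁻¹ * (a : ℝ) ^ (1 / 4 : ℝ) = (a : ℝ) ^ (-(7 / 4 : ℝ)) := by
          rw [← Real.rpow_natCast (a : ℝ) 2, ← Real.rpow_neg ha0.le, ← Real.rpow_add ha0]
          norm_num
        have e2 : (((b : ℝ)) ^ 2)⁻¹ * (b : ℝ) ^ (1 / 2 : ℝ) = (b : ℝ) ^ (-(3 / 2 : ℝ)) := by
          rw [← Real.rpow_natCast (b : ℝ) 2, ← Real.rpow_neg hb0.le, ← Real.rpow_add hb0]
          norm_num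
        calc ((((a : ℝ)) ^ 2)⁻¹ * (((b : ℝ)) ^ 2)⁻¹) *
              ((b : ℝ) ^ (1 / 2 : ℝ) * (a : ℝ) ^ (1 / 4 : ℝ) / (1 / 4))
            = 4 * (((((a : ℝ)) ^ 2)⁻¹ * (a : ℝ) ^ (1 / 4 : ℝ)) *
                ((((b : ℝ)) ^ 2)⁻¹ * (b : ℝ) ^ (1 / 2 : ℝ))) := by ring
          _ = _ := by rw [e1, e2]; ring

/-- `n ↦ n⁻²` as a monoid-with-zero hom (completely multiplicative). [folklore] -/
def sqInv : ℕ →*₀ ℝ where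
  toFun n := ((n : ℝ) ^ 2)⁻¹
  map_zero' := by simp
  map_one' := by simp
  map_mul' m n := by push_cast; rw [mul_pow, mul_inv]

/-- Unfolding `sqInv`. [folklore] -/
@[simp] private theorem sqInv_apply (n : ℕ) : sqInv n = ((n : ℝ) ^ 2)⁻¹ := rfl

/-- The local factor of `h` at a prime: `Σ_e h(p^e) = 1 + Σ_{e ≥ 1} p^{−e}/(p+1) = (1 − p⁻²)⁻¹`.
[folklore] -/
private theorem hasSum_Hh_prime_pow {p : ℕ} (hp : p.Prime) :
    HasSum (fun e : ℕ ↦ Hh (p ^ e)) ((1 - ((p : ℝ) ^ 2)⁻¹)⁻¹) := by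
  have hp1 : (1 : ℝ) < p := by exact_mod_cast hp.one_lt
  have hp0 : (0 : ℝ) < p := by linarith
  set r : ℝ := (p : ℝ)⁻¹ with hr
  have hr0 : 0 ≤ r := by positivity
  have hr1 : r < 1 := inv_lt_one_of_one_lt₀ hp1
  -- the shifted series `e ↦ h(p^{e+1}) = r^e · (p⁻¹ (p+1)⁻¹)`
  have hshift : HasSum (fun e : ℕ ↦ Hh (p ^ (e + 1))) ((1 - r)⁻¹ * ((p : ℝ)⁻¹ * ((p : ℝ) + 1)⁻¹)) := by
    have hg := (hasSum_geometric_of_lt_one hr0 hr1).mul_right ((p : ℝ)⁻¹ * ((p : ℝ) + 1)⁻¹)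
    refine hg.congr_fun fun e ↦ ?_
    rw [Hh_apply_prime_pow hp (Nat.succ_ne_zero e), hr, pow_succ, mul_inv, inv_pow]
    ring
  have h := (hasSum_nat_add_iff (f := fun e : ℕ ↦ Hh (p ^ e)) 1).mp hshift
  simp only [Finset.range_one, Finset.sum_singleton, pow_zero, isMultiplicative_Hh.map_one] at h
  have hp1' : (p : ℝ) - 1 ≠ 0 := by linarith
  have hp2 : (p : ℝ) + 1 ≠ 0 := by linarith
  have hp3 : (p : ℝ) ^ 2 - 1 ≠ 0 := by nlinarith
  have key : (1 - r)⁻¹ * ((p : ℝ)⁻¹ * ((p : ℝ) + 1)⁻¹) + 1 = (1 - ((p : ℝ) ^ 2)⁻¹)⁻¹ := by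
    rw [hr]
    field_simp
    ring
  rwa [key] at h

/-- **`Σ_n h(n) = ζ(2) = π²/6`** (Euler products: `∏_p Σ_e h(p^e) = ∏_p (1 − p⁻²)⁻¹ = Σ n⁻²`); this
is KMV's «`η₁(0,0,0) = ζ(2)`». [cite: KowalskiMichelVanderKam2000, §4 (18) (η₁(0,0,0) = ζ(2))] -/
theorem hasSum_Hh : HasSum (fun n ↦ Hh n) (π ^ 2 / 6) := by
  have hsum : Summable (fun n ↦ ‖Hh n‖) :=
    summable_Hh.congr fun n ↦ by rw [Real.norm_eq_abs, abs_of_nonneg (Hh_nonneg n)]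
  have h1 : ∏' p : Nat.Primes, ∑' e, Hh (p ^ e) = ∑' n, Hh n :=
    isMultiplicative_Hh.eulerProduct_tprod hsum
  have h2 : ∏' p : Nat.Primes, ∑' e : ℕ, Hh (p ^ e) = ∏' p : Nat.Primes, (1 - sqInv p)⁻¹ :=
    tprod_congr fun p ↦ by rw [(hasSum_Hh_prime_pow p.2).tsum_eq, sqInv_apply]
  have hsum' : Summable (fun n ↦ ‖sqInv n‖) := by
    refine (Real.summable_nat_pow_inv.mpr one_lt_two).congr fun n ↦ ?_
    rw [sqInv_apply, Real.norm_eq_abs, abs_of_nonneg (by positivity)]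
  have h3 : ∏' p : Nat.Primes, (1 - sqInv p)⁻¹ = ∑' n, sqInv n :=
    EulerProduct.eulerProduct_completely_multiplicative_tprod hsum'
  have h4 : ∑' n : ℕ, sqInv n = π ^ 2 / 6 := by
    rw [← hasSum_zeta_two.tsum_eq]
    exact tsum_congr fun n ↦ by rw [sqInv_apply, one_div]
  have : ∑' n, Hh n = π ^ 2 / 6 := by rw [← h1, h2, h3, h4]
  rw [← this]
  exact summable_Hh.hasSum

/-! ## §9. Elementary inequalities, Abel summation, and `Σ_{d ≤ y} μ(d) logⁱd/d = O(1)` for `i ≥ 2` -/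

/-- `x^k − y^k ≤ k x^{k−1} (x − y)` for `0 ≤ y ≤ x`. [folklore] -/
private theorem pow_sub_pow_le {x y : ℝ} (hy : 0 ≤ y) (hxy : y ≤ x) (k : ℕ) :
    x ^ k - y ^ k ≤ k * x ^ (k - 1) * (x - y) := by
  induction k with
  | zero => simp
  | succ k ih =>
    have hx : 0 ≤ x := hy.trans hxy
    rw [pow_succ, pow_succ, Nat.add_sub_cancel]
    have e : x ^ k * x - y ^ k * y = (x ^ k - y ^ k) * x + y ^ k * (x - y) := by ring
    rw [e]
    have h1 : (x ^ k - y ^ k) * x ≤ (k * x ^ (k - 1) * (x - y)) * x :=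
      mul_le_mul_of_nonneg_right ih hx
    have h2 : y ^ k * (x - y) ≤ x ^ k * (x - y) :=
      mul_le_mul_of_nonneg_right (pow_le_pow_left₀ hy hxy k) (by linarith)
    have h3 : (k : ℝ) * x ^ (k - 1) * (x - y) * x ≤ k * x ^ k * (x - y) := by
      rcases Nat.eq_zero_or_pos k with rfl | hk
      · simp
      · have : x ^ (k - 1) * x = x ^ k := by
          rw [← pow_succ, Nat.sub_add_cancel hk]
        calc (k : ℝ) * x ^ (k - 1) * (x - y) * x = k * (x ^ (k - 1) * x) * (x - y) := by ring
          _ = k * x ^ k * (x - y) := by rw [this]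
        exact le_rfl
    push_cast
    nlinarith

/-- `e^{−t} ≤ k!/t^k` for `t > 0`. [folklore] -/
private theorem exp_neg_le_factorial_div_pow {t : ℝ} (ht : 0 < t) (k : ℕ) :
    Real.exp (-t) ≤ (k.factorial : ℝ) / t ^ k := by
  have h := Real.pow_div_factorial_le_exp t ht.le k
  have hk : (0 : ℝ) < k.factorial := by exact_mod_cast k.factorial_pos
  rw [Real.exp_neg, inv_eq_one_div, div_le_div_iff₀ (Real.exp_pos t) (pow_pos ht k)]
  rw [div_le_iff₀ hk] at h
  linarith

/-- `Lʲ e^{−c√L} ≤ (2j)!/c^{2j}` for `L > 0`, `c > 0`. [folklore] -/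
private theorem pow_mul_exp_neg_sqrt_le {L c : ℝ} (hL : 0 < L) (hc : 0 < c) (j : ℕ) :
    L ^ j * Real.exp (-(c * Real.sqrt L)) ≤ ((2 * j).factorial : ℝ) / c ^ (2 * j) := by
  set u := Real.sqrt L with hu
  have hu0 : 0 < u := Real.sqrt_pos.2 hL
  have hL' : L = u ^ 2 := (Real.sq_sqrt hL.le).symm
  have h := exp_neg_le_factorial_div_pow (mul_pos hc hu0) (2 * j)
  rw [hL', ← pow_mul]
  calc u ^ (2 * j) * Real.exp (-(c * u)) ≤ u ^ (2 * j) * (((2 * j).factorial : ℝ) / (c * u) ^ (2 * j)) :=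
        mul_le_mul_of_nonneg_left h (by positivity)
    _ = ((2 * j).factorial : ℝ) / c ^ (2 * j) := by
        rw [mul_pow]
        field_simp

/-- `1/(n log² n) ≤ 1/log(n−1) − 1/log n` for `n ≥ 3`. [folklore] -/
private theorem inv_mul_log_sq_le {n : ℕ} (hn : 3 ≤ n) :
    ((n : ℝ) * Real.log n ^ 2)⁻¹ ≤ (Real.log (n - 1 : ℝ))⁻¹ - (Real.log n)⁻¹ := by
  have hn3 : (3 : ℝ) ≤ n := by exact_mod_cast hn
  have hn0 : (0 : ℝ) < n := by linarith
  have hn1 : (1 : ℝ) < (n : ℝ) - 1 := by linarith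
  have hl1 : 0 < Real.log ((n : ℝ) - 1) := Real.log_pos hn1
  have hl2 : Real.log ((n : ℝ) - 1) ≤ Real.log n := Real.log_le_log (by linarith) (by linarith)
  have hl3 : 0 < Real.log n := lt_of_lt_of_le hl1 hl2
  -- `log n − log(n−1) = log(n/(n−1)) ≥ 1 − (n−1)/n = 1/n`
  have hdiff : (n : ℝ)⁻¹ ≤ Real.log n - Real.log ((n : ℝ) - 1) := by
    have h := Real.one_sub_inv_le_log_of_pos (show (0 : ℝ) < n / (n - 1) by positivity)
    rw [Real.log_div hn0.ne' (by linarith), inv_div] at h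
    have e : 1 - ((n : ℝ) - 1) / n = (n : ℝ)⁻¹ := by field_simp; ring
    linarith
  rw [show (Real.log ((n : ℝ) - 1))⁻¹ - (Real.log n)⁻¹ =
      (Real.log n - Real.log ((n : ℝ) - 1)) / (Real.log n * Real.log ((n : ℝ) - 1)) by
    field_simp]
  rw [inv_eq_one_div, div_le_div_iff₀ (by positivity) (by positivity)]
  calc 1 * (Real.log n * Real.log ((n : ℝ) - 1)) ≤ 1 * (Real.log n * Real.log n) := by
        gcongr
    _ = (n : ℝ)⁻¹ * ((n : ℝ) * Real.log n ^ 2) := by field_simp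
    _ ≤ (Real.log n - Real.log ((n : ℝ) - 1)) * ((n : ℝ) * Real.log n ^ 2) :=
        mul_le_mul_of_nonneg_right hdiff (by positivity)

/-- The telescoped bound `Σ_{3 ≤ n ≤ N} 1/(n log² n) ≤ 1/log 2`. [folklore] -/
private theorem sum_inv_mul_log_sq_le (N : ℕ) :
    ∑ n ∈ Finset.Icc 3 N, ((n : ℝ) * Real.log n ^ 2)⁻¹ ≤ (Real.log 2)⁻¹ := by
  have hl2 : 0 < Real.log 2 := Real.log_pos (by norm_num)
  suffices h : ∀ N : ℕ, 2 ≤ N →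
      ∑ n ∈ Finset.Icc 3 N, ((n : ℝ) * Real.log n ^ 2)⁻¹ ≤ (Real.log 2)⁻¹ - (Real.log N)⁻¹ by
    rcases lt_or_ge N 2 with hN | hN
    · rw [Finset.Icc_eq_empty (by omega), Finset.sum_empty]
      positivity
    · have hN' : (1 : ℝ) < N := by exact_mod_cast lt_of_lt_of_le (by norm_num) hN
      exact (h N hN).trans (sub_le_self _ (inv_nonneg.2 (Real.log_pos hN').le))
  intro N hN
  induction N with
  | zero => omega
  | succ N ih =>
    rcases eq_or_lt_of_le hN with h2 | h2
    · rw [← h2, Finset.Icc_eq_empty (by omega), Finset.sum_empty]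
      norm_num
    · have hN2 : 2 ≤ N := by omega
      rw [Finset.sum_Icc_succ_top (by omega)]
      have hstep := inv_mul_log_sq_le (show 3 ≤ N + 1 by omega)
      push_cast at hstep ⊢
      simp only [add_sub_cancel_right] at hstep
      linarith [ih hN2]

/-- Abel summation on `[1, N]`: `Σ_{d ≤ N} a_d b_d = A(N) b(N) − Σ_{1 ≤ n < N} A(n)(b(n+1) − b(n))`,
`A(n) = Σ_{d ≤ n} a_d`. [folklore] -/
private theorem sum_Icc_mul_eq_abel (a b : ℕ → ℝ) (N : ℕ) :
    ∑ d ∈ Finset.Icc 1 N, a d * b d =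
      (∑ d ∈ Finset.Icc 1 N, a d) * b N -
        ∑ n ∈ Finset.Ico 1 N, (∑ d ∈ Finset.Icc 1 n, a d) * (b (n + 1) - b n) := by
  induction N with
  | zero => simp
  | succ N ih =>
    rw [Finset.sum_Icc_succ_top (by omega), Finset.sum_Icc_succ_top (by omega), ih]
    rcases Nat.eq_zero_or_pos N with rfl | hN
    · simp
    · rw [Finset.sum_Ico_succ_top hN]
      ring

/-- The logarithmic power sums of Möbius: `m_i(N) = Σ_{d ≤ N} μ(d) logⁱd / d`. [folklore] -/
def moebiusLogPowSum (i N : ℕ) : ℝ :=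
  ∑ d ∈ Finset.Icc 1 N, (μ d : ℝ) * Real.log d ^ i / d

/-- `m₀(N) = Σ_{d≤N} μ(d)/d`. [folklore] -/
private theorem moebiusLogPowSum_zero (N : ℕ) :
    moebiusLogPowSum 0 N = ∑ d ∈ Finset.Icc 1 N, (μ d : ℝ) / d := by
  simp [moebiusLogPowSum]

/-- `m₁(N) = Σ_{d≤N} μ(d) log d/d`. [folklore] -/
private theorem moebiusLogPowSum_one (N : ℕ) :
    moebiusLogPowSum 1 N = ∑ d ∈ Finset.Icc 1 N, (μ d : ℝ) * Real.log d / d := by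
  simp [moebiusLogPowSum]

/-- **`Σ_{d ≤ N} μ(d) logⁱ d / d = O_i(1)` for `i ≥ 2`** (Abel summation from
`Σ_{d ≤ n} μ(d) log d/d = −1 + O(e^{−c√log n})`, the increments of `log^{i−1}` being
`≤ (i−1)log^{i−2}(n+1)/n` and `e^{−c√log n} ≪_i log^{−i} n`, with `Σ 1/(n log² n) < ∞`).
[cite: MontgomeryVaughan2007, §8.1 (8.8)] -/
theorem abs_moebiusLogPowSum_le {i : ℕ} (hi : 2 ≤ i) : ∃ B : ℝ, ∀ N : ℕ, |moebiusLogPowSum i N| ≤ B := by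
  obtain ⟨c, hc, C, hC⟩ := abs_sum_moebius_mul_log_div_add_one_le
  -- the data
  set a : ℕ → ℝ := fun d ↦ (μ d : ℝ) * Real.log d / d with ha
  set b : ℕ → ℝ := fun d ↦ Real.log d ^ (i - 1) with hb
  set A : ℕ → ℝ := fun n ↦ ∑ d ∈ Finset.Icc 1 n, a d with hA
  set ε : ℕ → ℝ := fun n ↦ A n + 1 with hε
  have hεb : ∀ n : ℕ, 2 ≤ n → |ε n| ≤ C * Real.exp (-c * Real.sqrt (Real.log n)) := fun n hn ↦
    hC n (by exact_mod_cast hn) |>.trans_eq' (by simp [hε, hA, ha, Nat.floor_natCast])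
  have hC0 : 0 ≤ C := by
    have h := hεb 2 le_rfl
    have he : 0 < Real.exp (-c * Real.sqrt (Real.log ((2 : ℕ) : ℝ))) := Real.exp_pos _
    by_contra hC'
    push Not at hC'
    have := mul_neg_of_neg_of_pos hC' he
    linarith [abs_nonneg (ε 2)]
  -- constants
  set K₁ : ℝ := C * (((2 * (i - 1)).factorial : ℝ) / c ^ (2 * (i - 1))) with hK₁
  set K₂ : ℝ := C * (((2 * i).factorial : ℝ) / c ^ (2 * i)) * ((i - 1 : ℕ) * 2 ^ (i - 2)) with hK₂
  refine ⟨K₁ + Real.log 2 ^ (i - 1) + K₂ * ((2 * Real.log 2 ^ 2)⁻¹ + (Real.log 2)⁻¹), fun N ↦ ?_⟩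
  have hl2 : 0 < Real.log 2 := Real.log_pos (by norm_num)
  have hK₁0 : 0 ≤ K₁ := by positivity
  have hK₂0 : 0 ≤ K₂ := by positivity
  rcases Nat.eq_zero_or_pos N with rfl | hN
  · have hI : Finset.Icc 1 0 = ∅ := Finset.Icc_eq_empty (by omega)
    unfold moebiusLogPowSum
    rw [hI, Finset.sum_empty, abs_zero]
    positivity
  -- Abel summation
  have hmi : moebiusLogPowSum i N = ∑ d ∈ Finset.Icc 1 N, a d * b d := by
    simp only [moebiusLogPowSum, ha, hb]
    refine Finset.sum_congr rfl fun d _ ↦ ?_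
    have : Real.log d ^ i = Real.log d * Real.log d ^ (i - 1) := by
      rw [← pow_succ', Nat.sub_add_cancel (by omega)]
    rw [this]
    ring
  have hb0 : ∀ n : ℕ, 0 ≤ b n := fun n ↦ by
    simp only [hb]; exact pow_nonneg (Real.log_natCast_nonneg n) _
  have hbmono : ∀ n : ℕ, 1 ≤ n → b n ≤ b (n + 1) := fun n hn ↦ by
    simp only [hb]
    exact pow_le_pow_left₀ (Real.log_natCast_nonneg n)
      (Real.log_le_log (by exact_mod_cast hn) (by push_cast; linarith)) _
  have hb1 : b 1 = 0 := by simp [hb, zero_pow (by omega : i - 1 ≠ 0)]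
  -- `Σ_{Ico 1 N} (b(n+1) − b(n)) = b N`
  have htel : ∑ n ∈ Finset.Ico 1 N, (b (n + 1) - b n) = b N := by
    have : ∀ M : ℕ, 1 ≤ M → ∑ n ∈ Finset.Ico 1 M, (b (n + 1) - b n) = b M - b 1 := by
      intro M hM
      induction M with
      | zero => omega
      | succ M ih =>
        rcases Nat.eq_zero_or_pos M with rfl | hM0
        · simp
        · rw [Finset.sum_Ico_succ_top hM0, ih hM0]; ring
    rw [this N hN, hb1, sub_zero]
  rw [hmi, sum_Icc_mul_eq_abel]
  -- rewrite `A = ε − 1`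
  have hAε : ∀ n, A n = ε n - 1 := fun n ↦ by simp [hε]
  have hmain : (∑ d ∈ Finset.Icc 1 N, a d) * b N -
      ∑ n ∈ Finset.Ico 1 N, (∑ d ∈ Finset.Icc 1 n, a d) * (b (n + 1) - b n) =
      ε N * b N - ∑ n ∈ Finset.Ico 1 N, ε n * (b (n + 1) - b n) := by
    change A N * b N - ∑ n ∈ Finset.Ico 1 N, A n * (b (n + 1) - b n) = _
    have hs : ∑ n ∈ Finset.Ico 1 N, A n * (b (n + 1) - b n) =
        ∑ n ∈ Finset.Ico 1 N, ε n * (b (n + 1) - b n) - ∑ n ∈ Finset.Ico 1 N, (b (n + 1) - b n) := by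
      rw [← Finset.sum_sub_distrib]
      exact Finset.sum_congr rfl fun n _ ↦ by rw [hAε]; ring
    rw [hs, htel, hAε]
    ring
  rw [hmain]
  -- bound 1: `|ε N b N| ≤ K₁`
  have h1 : |ε N * b N| ≤ K₁ := by
    rcases eq_or_lt_of_le (show 1 ≤ N from hN) with h1N | h1N
    · rw [← h1N, hb1, mul_zero, abs_zero]; exact hK₁0
    · have hN2 : 2 ≤ N := by omega
      have hlN : 0 < Real.log N := Real.log_pos (by exact_mod_cast h1N)
      rw [abs_mul, abs_of_nonneg (hb0 N)]
      calc |ε N| * b N ≤ C * Real.exp (-c * Real.sqrt (Real.log N)) * Real.log N ^ (i - 1) :=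
            mul_le_mul_of_nonneg_right (hεb N hN2) (hb0 N)
        _ = C * (Real.log N ^ (i - 1) * Real.exp (-(c * Real.sqrt (Real.log N)))) := by
            rw [neg_mul]; ring
        _ ≤ C * (((2 * (i - 1)).factorial : ℝ) / c ^ (2 * (i - 1))) :=
            mul_le_mul_of_nonneg_left (pow_mul_exp_neg_sqrt_le hlN hc _) hC0
  -- bound 2: the increments, `n ≥ 2`: `|ε n| (b(n+1) − b n) ≤ K₂ /(n log² n)`
  have h2 : ∀ n : ℕ, 2 ≤ n → |ε n| * (b (n + 1) - b n) ≤ K₂ * ((n : ℝ) * Real.log n ^ 2)⁻¹ := by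
    intro n hn
    have hn1 : (1 : ℝ) < n := by exact_mod_cast lt_of_lt_of_le (by norm_num) hn
    have hn0 : (0 : ℝ) < n := by linarith
    have hln : 0 < Real.log n := Real.log_pos hn1
    have hln1 : Real.log n ≤ Real.log (n + 1) := Real.log_le_log hn0 (by linarith)
    -- increment of `log^{i-1}`
    have hinc : b (n + 1) - b n ≤ ((i - 1 : ℕ) : ℝ) * (2 ^ (i - 2) * Real.log n ^ (i - 2)) * (n : ℝ)⁻¹ := by
      have hdl : Real.log (n + 1) - Real.log n ≤ (n : ℝ)⁻¹ := by
        rw [← Real.log_div (by linarith) hn0.ne']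
        have := Real.log_le_sub_one_of_pos (show (0 : ℝ) < (n + 1) / n by positivity)
        have e : ((n : ℝ) + 1) / n - 1 = (n : ℝ)⁻¹ := by field_simp; ring
        linarith
      have hl2n : Real.log (n + 1) ≤ 2 * Real.log n := by
        have hn2 : (2 : ℝ) ≤ n := by exact_mod_cast hn
        rw [← Real.log_rpow hn0, show (2 : ℝ) = ((2 : ℕ) : ℝ) by norm_num, Real.rpow_natCast]
        exact Real.log_le_log (by linarith) (by nlinarith)
      have hp := pow_sub_pow_le (Real.log_natCast_nonneg n) hln1 (i - 1)
      simp only [hb]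
      push_cast at hp ⊢
      have hi1 : i - 1 - 1 = i - 2 := by omega
      rw [hi1] at hp
      have hl0 : 0 ≤ Real.log (n + 1) := (Real.log_natCast_nonneg n).trans hln1
      calc Real.log (n + 1) ^ (i - 1) - Real.log n ^ (i - 1)
          ≤ ((i - 1 : ℕ) : ℝ) * Real.log (n + 1) ^ (i - 2) * (Real.log (n + 1) - Real.log n) := by
            exact_mod_cast hp
        _ ≤ ((i - 1 : ℕ) : ℝ) * (2 * Real.log n) ^ (i - 2) * (n : ℝ)⁻¹ :=
            mul_le_mul (mul_le_mul_of_nonneg_left (pow_le_pow_left₀ hl0 hl2n _) (by positivity))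
              hdl (sub_nonneg.2 hln1) (by positivity)
        _ = ((i - 1 : ℕ) : ℝ) * (2 ^ (i - 2) * Real.log n ^ (i - 2)) * (n : ℝ)⁻¹ := by
            rw [mul_pow]
    -- size of ε
    have hεn : |ε n| ≤ C * (((2 * i).factorial : ℝ) / c ^ (2 * i)) * (Real.log n ^ i)⁻¹ := by
      refine (hεb n hn).trans ?_
      have ht : 0 < c * Real.sqrt (Real.log n) := mul_pos hc (Real.sqrt_pos.2 hln)
      have he := exp_neg_le_factorial_div_pow ht (2 * i)
      rw [neg_mul]
      have hsq : Real.sqrt (Real.log n) ^ (2 * i) = Real.log n ^ i := by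
        rw [pow_mul, Real.sq_sqrt hln.le]
      rw [mul_pow, hsq] at he
      calc C * Real.exp (-(c * Real.sqrt (Real.log n)))
          ≤ C * (((2 * i).factorial : ℝ) / (c ^ (2 * i) * Real.log n ^ i)) :=
            mul_le_mul_of_nonneg_left he hC0
        _ = C * (((2 * i).factorial : ℝ) / c ^ (2 * i)) * (Real.log n ^ i)⁻¹ := by
            field_simp
    have hinc0 : 0 ≤ b (n + 1) - b n := sub_nonneg.2 (hbmono n (by omega))
    calc |ε n| * (b (n + 1) - b n)
        ≤ (C * (((2 * i).factorial : ℝ) / c ^ (2 * i)) * (Real.log n ^ i)⁻¹) *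
            (((i - 1 : ℕ) : ℝ) * (2 ^ (i - 2) * Real.log n ^ (i - 2)) * (n : ℝ)⁻¹) :=
          mul_le_mul hεn hinc hinc0 (by positivity)
      _ = K₂ * ((n : ℝ) * Real.log n ^ 2)⁻¹ := by
          rw [hK₂]
          have : Real.log n ^ i = Real.log n ^ (i - 2) * Real.log n ^ 2 := by
            rw [← pow_add, Nat.sub_add_cancel hi]
          rw [this]
          field_simp
  -- assemble bound 2 over `Ico 1 N`: split `n = 1`, `n = 2`, `n ≥ 3`
  have h3 : |∑ n ∈ Finset.Ico 1 N, ε n * (b (n + 1) - b n)| ≤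
      Real.log 2 ^ (i - 1) + K₂ * ((2 * Real.log 2 ^ 2)⁻¹ + (Real.log 2)⁻¹) := by
    refine (Finset.abs_sum_le_sum_abs _ _).trans ?_
    have hterm : ∀ n ∈ Finset.Ico 1 N, |ε n * (b (n + 1) - b n)| ≤
        (if n = 1 then Real.log 2 ^ (i - 1) else K₂ * ((n : ℝ) * Real.log n ^ 2)⁻¹) := by
      intro n hn
      have hn1 : 1 ≤ n := (Finset.mem_Ico.1 hn).1
      rw [abs_mul, abs_of_nonneg (sub_nonneg.2 (hbmono n hn1))]
      split_ifs with h
      · subst h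
        have hε1 : ε 1 = 1 := by simp [hε, hA, ha]
        rw [hε1, hb1]
        simp [hb]
      · exact h2 n (by omega)
    refine (Finset.sum_le_sum hterm).trans ?_
    -- the sum of the majorants
    have hsplit : ∑ n ∈ Finset.Ico 1 N,
        (if n = 1 then Real.log 2 ^ (i - 1) else K₂ * ((n : ℝ) * Real.log n ^ 2)⁻¹) ≤
        Real.log 2 ^ (i - 1) + K₂ * ∑ n ∈ Finset.Icc 2 N, ((n : ℝ) * Real.log n ^ 2)⁻¹ := by
      have hsub : Finset.Ico 1 N ⊆ insert 1 (Finset.Icc 2 N) := by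
        intro n hn
        rw [Finset.mem_insert, Finset.mem_Icc]
        rw [Finset.mem_Ico] at hn
        omega
      refine (Finset.sum_le_sum_of_subset_of_nonneg hsub fun n _ _ ↦ ?_).trans ?_
      · split_ifs <;> positivity
      rw [Finset.sum_insert (by simp), if_pos rfl, Finset.mul_sum]
      gcongr with n hn
      rw [if_neg (by have := (Finset.mem_Icc.1 hn).1; omega)]
    refine hsplit.trans ?_
    have hIcc : ∑ n ∈ Finset.Icc 2 N, ((n : ℝ) * Real.log n ^ 2)⁻¹ ≤
        (2 * Real.log 2 ^ 2)⁻¹ + (Real.log 2)⁻¹ := by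
      rcases lt_or_ge N 2 with hN2 | hN2
      · rw [Finset.Icc_eq_empty (by omega), Finset.sum_empty]; positivity
      · have : Finset.Icc 2 N = insert 2 (Finset.Icc 3 N) := by
          ext n; simp [Finset.mem_Icc]; omega
        rw [this, Finset.sum_insert (by simp)]
        push_cast
        linarith [sum_inv_mul_log_sq_le N]
    gcongr
  calc |ε N * b N - ∑ n ∈ Finset.Ico 1 N, ε n * (b (n + 1) - b n)|
      ≤ |ε N * b N| + |∑ n ∈ Finset.Ico 1 N, ε n * (b (n + 1) - b n)| := abs_sub _ _
    _ ≤ K₁ + (Real.log 2 ^ (i - 1) + K₂ * ((2 * Real.log 2 ^ 2)⁻¹ + (Real.log 2)⁻¹)) :=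
        add_le_add h1 h3
    _ = _ := by ring

/-! ## §10. The Möbius logarithmic Riesz means `R_j(y) = Σ_{d ≤ y} μ(d)/d · logʲ(y/d) = j log^{j−1} y + O(1 + log^{j−2} y)` -/

/-- `R_j(y) = Σ_{d ≤ y} μ(d) d⁻¹ logʲ(y/d)`. [folklore] -/
def moebiusRiesz (j : ℕ) (y : ℝ) : ℝ :=
  ∑ d ∈ Finset.Icc 1 ⌊y⌋₊, (μ d : ℝ) / d * Real.log (y / d) ^ j

/-- Binomial expansion: `R_j(y) = Σ_{m ≤ j} C(j,m) (log y)^{j−m} (−1)^m m_m(⌊y⌋)`. [folklore] -/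
private theorem moebiusRiesz_eq_sum (j : ℕ) {y : ℝ} (hy : 1 ≤ y) :
    moebiusRiesz j y = ∑ m ∈ Finset.range (j + 1),
      (j.choose m : ℝ) * Real.log y ^ (j - m) * ((-1) ^ m * moebiusLogPowSum m ⌊y⌋₊) := by
  unfold moebiusRiesz moebiusLogPowSum
  have hexp : ∀ d ∈ Finset.Icc 1 ⌊y⌋₊, (μ d : ℝ) / d * Real.log (y / d) ^ j =
      ∑ m ∈ Finset.range (j + 1), (j.choose m : ℝ) * Real.log y ^ (j - m) *
        ((-1) ^ m * ((μ d : ℝ) * Real.log d ^ m / d)) := by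
    intro d hd
    have hd0 : (0 : ℝ) < d := by exact_mod_cast (Finset.mem_Icc.1 hd).1
    rw [Real.log_div (by linarith) hd0.ne', sub_eq_neg_add, add_pow, Finset.mul_sum]
    refine Finset.sum_congr rfl fun m _ ↦ ?_
    rw [neg_pow]
    ring
  rw [Finset.sum_congr rfl hexp, Finset.sum_comm]
  refine Finset.sum_congr rfl fun m _ ↦ ?_
  rw [Finset.mul_sum, Finset.mul_sum]

/-- **`R_j(y) = j log^{j−1} y + O_j(1 + log^{j−2} y)` uniformly in `y ≥ 1`** (`j ≥ 1`), from the
tree's `Σ_{d≤y} μ(d)/d ≪ e^{−c√log y}`, `Σ_{d≤y} μ(d) log d/d = −1 + O(e^{−c√log y})` and §9.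
[cite: MontgomeryVaughan2007, §8.1 (8.6)–(8.8)] -/
theorem abs_moebiusRiesz_sub_le {j : ℕ} (hj : 1 ≤ j) :
    ∃ A : ℝ, ∀ y : ℝ, 1 ≤ y →
      |moebiusRiesz j y - j * Real.log y ^ (j - 1)| ≤ A * (1 + Real.log y ^ (j - 2)) := by
  classical
  obtain ⟨c₀, hc₀, C₀, hC₀⟩ := abs_sum_moebius_div_le_exp_neg_sqrt_log
  obtain ⟨c₁, hc₁, C₁, hC₁⟩ := abs_sum_moebius_mul_log_div_add_one_le
  -- uniform constants for the higher sums
  have hB : ∀ m : ℕ, ∃ B : ℝ, 0 ≤ B ∧ (2 ≤ m → ∀ N : ℕ, |moebiusLogPowSum m N| ≤ B) := by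
    intro m
    by_cases hm : 2 ≤ m
    · obtain ⟨B, hB⟩ := abs_moebiusLogPowSum_le hm
      exact ⟨max B 0, le_max_right _ _, fun _ N ↦ (hB N).trans (le_max_left _ _)⟩
    · exact ⟨0, le_rfl, fun h ↦ absurd h hm⟩
  choose B hB0 hB using hB
  set C₀' := max C₀ 0 with hC₀'
  set C₁' := max C₁ 0 with hC₁'
  set A₀ : ℝ := C₀' * (((2 * j).factorial : ℝ) / c₀ ^ (2 * j)) with hA₀
  set A₁ : ℝ := j * (C₁' * (((2 * (j - 1)).factorial : ℝ) / c₁ ^ (2 * (j - 1)))) with hA₁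
  set A₂ : ℝ := ∑ m ∈ Finset.Icc 2 j, (j.choose m : ℝ) * B m with hA₂
  have hA₀0 : 0 ≤ A₀ := by positivity
  have hA₁0 : 0 ≤ A₁ := by positivity
  have hA₂0 : 0 ≤ A₂ := Finset.sum_nonneg fun m _ ↦ mul_nonneg (by positivity) (hB0 m)
  refine ⟨A₀ + A₁ + A₂ + (j + 1), fun y hy ↦ ?_⟩
  have hlogy : 0 ≤ Real.log y := Real.log_nonneg hy
  rcases lt_or_ge y 2 with hy2 | hy2
  · -- `1 ≤ y < 2`: only `d = 1`
    have hfl : ⌊y⌋₊ = 1 := by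
      rw [Nat.floor_eq_iff (by linarith)]
      constructor <;> push_cast <;> linarith
    have hR : moebiusRiesz j y = Real.log y ^ j := by
      simp [moebiusRiesz, hfl]
    have hl1 : Real.log y ≤ 1 := by
      have := Real.log_le_sub_one_of_pos (show (0 : ℝ) < y by linarith)
      linarith
    have hp1 : Real.log y ^ j ≤ 1 := pow_le_one₀ hlogy hl1
    have hp2 : Real.log y ^ (j - 1) ≤ 1 := pow_le_one₀ hlogy hl1
    rw [hR]
    have hj0 : (0 : ℝ) ≤ j := Nat.cast_nonneg j
    calc |Real.log y ^ j - j * Real.log y ^ (j - 1)|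
        ≤ |Real.log y ^ j| + |(j : ℝ) * Real.log y ^ (j - 1)| := abs_sub _ _
      _ ≤ 1 + j := by
          rw [abs_of_nonneg (pow_nonneg hlogy _), abs_of_nonneg (by positivity)]
          exact add_le_add hp1 (mul_le_of_le_one_right hj0 hp2)
      _ ≤ (A₀ + A₁ + A₂ + (j + 1)) * (1 + Real.log y ^ (j - 2)) := by
          have : (1 : ℝ) ≤ 1 + Real.log y ^ (j - 2) := by
            linarith [pow_nonneg hlogy (j - 2)]
          nlinarith
  -- `y ≥ 2`: expand and split off `m = 0, 1`
  have hlogy' : 0 < Real.log y := Real.log_pos (by linarith)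
  rw [moebiusRiesz_eq_sum j hy]
  obtain ⟨k, rfl⟩ : ∃ k, j = k + 1 := ⟨j - 1, by omega⟩
  rw [Finset.sum_range_succ', Finset.sum_range_succ']
  simp only [Nat.choose_zero_right, Nat.cast_one, one_mul, pow_zero, Nat.sub_zero,
    Nat.choose_one_right, pow_one, zero_add, Nat.add_sub_cancel]
  set L := Real.log y with hL
  set N := ⌊y⌋₊ with hN
  have hm0 : |moebiusLogPowSum 0 N| ≤ C₀' * Real.exp (-(c₀ * Real.sqrt L)) := by
    rw [moebiusLogPowSum_zero]
    refine (hC₀ y hy2).trans ?_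
    rw [neg_mul]
    exact mul_le_mul_of_nonneg_right (le_max_left _ _) (Real.exp_pos _).le
  have hm1 : |moebiusLogPowSum 1 N + 1| ≤ C₁' * Real.exp (-(c₁ * Real.sqrt L)) := by
    rw [moebiusLogPowSum_one]
    refine (hC₁ y hy2).trans ?_
    rw [neg_mul]
    exact mul_le_mul_of_nonneg_right (le_max_left _ _) (Real.exp_pos _).le
  -- the three pieces
  set T₂ := ∑ m ∈ Finset.range k,
      ((k + 1).choose (m + 1 + 1) : ℝ) * L ^ (k + 1 - (m + 1 + 1)) *
        ((-1) ^ (m + 1 + 1) * moebiusLogPowSum (m + 1 + 1) N) with hT₂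
  have e : T₂ + ((k + 1 : ℕ) : ℝ) * L ^ k * (-1 * moebiusLogPowSum 1 N) +
        L ^ (k + 1) * moebiusLogPowSum 0 N - ((k + 1 : ℕ) : ℝ) * L ^ k =
      T₂ + (-(((k + 1 : ℕ) : ℝ) * L ^ k * (moebiusLogPowSum 1 N + 1))) +
        L ^ (k + 1) * moebiusLogPowSum 0 N := by ring
  rw [e]
  -- bound `T₂`
  have hT₂b : |T₂| ≤ A₂ * (1 + L ^ (k + 1 - 2)) := by
    rw [hT₂, hA₂]
    refine (Finset.abs_sum_le_sum_abs _ _).trans ?_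
    have hre : ∑ m ∈ Finset.Icc 2 (k + 1), ((k + 1).choose m : ℝ) * B m =
        ∑ m ∈ Finset.range k, ((k + 1).choose (m + 1 + 1) : ℝ) * B (m + 1 + 1) := by
      rw [Finset.range_eq_Ico, Finset.sum_Ico_add' (fun m ↦ ((k + 1).choose m : ℝ) * B m) 0 k 2]
      have : Finset.Ico (0 + 2) (k + 2) = Finset.Icc 2 (k + 1) := by
        ext m; simp only [Finset.mem_Ico, Finset.mem_Icc]; omega
      rw [this]
    rw [hre, Finset.sum_mul]
    refine Finset.sum_le_sum fun m hm ↦ ?_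
    have hm' : m + 1 + 1 ≤ k + 1 := by
      have := Finset.mem_range.1 hm; omega
    rw [abs_mul, abs_mul, abs_mul, abs_of_nonneg (by positivity : (0 : ℝ) ≤ ((k + 1).choose (m + 1 + 1) : ℝ)),
      abs_pow, abs_of_nonneg hlogy'.le, abs_pow, abs_neg, abs_one, one_pow, one_mul]
    have hpow : L ^ (k + 1 - (m + 1 + 1)) ≤ 1 + L ^ (k + 1 - 2) := by
      rcases le_or_gt L 1 with hL1 | hL1
      · have : L ^ (k + 1 - (m + 1 + 1)) ≤ 1 := pow_le_one₀ hlogy'.le hL1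
        linarith [pow_nonneg hlogy'.le (k + 1 - 2)]
      · have : L ^ (k + 1 - (m + 1 + 1)) ≤ L ^ (k + 1 - 2) :=
          pow_le_pow_right₀ hL1.le (by omega)
        linarith
    calc ((k + 1).choose (m + 1 + 1) : ℝ) * L ^ (k + 1 - (m + 1 + 1)) * |moebiusLogPowSum (m + 1 + 1) N|
        ≤ ((k + 1).choose (m + 1 + 1) : ℝ) * (1 + L ^ (k + 1 - 2)) * B (m + 1 + 1) := by
          refine mul_le_mul (mul_le_mul_of_nonneg_left hpow (by positivity))
            (hB (m + 1 + 1) (by omega) N) (abs_nonneg _) (by positivity)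
      _ = ((k + 1).choose (m + 1 + 1) : ℝ) * B (m + 1 + 1) * (1 + L ^ (k + 1 - 2)) := by ring
  -- bound the `m = 1` piece
  have hT₁b : |(-(((k + 1 : ℕ) : ℝ) * L ^ k * (moebiusLogPowSum 1 N + 1)))| ≤ A₁ := by
    rw [abs_neg, abs_mul, abs_mul, abs_of_nonneg (by positivity : (0 : ℝ) ≤ ((k + 1 : ℕ) : ℝ)),
      abs_pow, abs_of_nonneg hlogy'.le, hA₁, Nat.add_sub_cancel]
    calc ((k + 1 : ℕ) : ℝ) * L ^ k * |moebiusLogPowSum 1 N + 1|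
        ≤ ((k + 1 : ℕ) : ℝ) * L ^ k * (C₁' * Real.exp (-(c₁ * Real.sqrt L))) :=
          mul_le_mul_of_nonneg_left hm1 (by positivity)
      _ = ((k + 1 : ℕ) : ℝ) * (C₁' * (L ^ k * Real.exp (-(c₁ * Real.sqrt L)))) := by ring
      _ ≤ ((k + 1 : ℕ) : ℝ) * (C₁' * (((2 * k).factorial : ℝ) / c₁ ^ (2 * k))) := by
          gcongr
          exact pow_mul_exp_neg_sqrt_le hlogy' hc₁ k
  -- bound the `m = 0` piece
  have hT₀b : |L ^ (k + 1) * moebiusLogPowSum 0 N| ≤ A₀ := by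
    rw [abs_mul, abs_pow, abs_of_nonneg hlogy'.le, hA₀]
    calc L ^ (k + 1) * |moebiusLogPowSum 0 N|
        ≤ L ^ (k + 1) * (C₀' * Real.exp (-(c₀ * Real.sqrt L))) :=
          mul_le_mul_of_nonneg_left hm0 (by positivity)
      _ = C₀' * (L ^ (k + 1) * Real.exp (-(c₀ * Real.sqrt L))) := by ring
      _ ≤ C₀' * (((2 * (k + 1)).factorial : ℝ) / c₀ ^ (2 * (k + 1))) :=
          mul_le_mul_of_nonneg_left (pow_mul_exp_neg_sqrt_le hlogy' hc₀ (k + 1)) (le_max_right _ _)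
  have h1L : (1 : ℝ) ≤ 1 + L ^ (k + 1 - 2) := by linarith [pow_nonneg hlogy'.le (k + 1 - 2)]
  calc |T₂ + -(((k + 1 : ℕ) : ℝ) * L ^ k * (moebiusLogPowSum 1 N + 1)) + L ^ (k + 1) * moebiusLogPowSum 0 N|
      ≤ |T₂| + |(-(((k + 1 : ℕ) : ℝ) * L ^ k * (moebiusLogPowSum 1 N + 1)))| +
          |L ^ (k + 1) * moebiusLogPowSum 0 N| := abs_add_three _ _ _
    _ ≤ A₂ * (1 + L ^ (k + 1 - 2)) + A₁ + A₀ := add_le_add (add_le_add hT₂b hT₁b) hT₀b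
    _ ≤ (A₀ + A₁ + A₂ + ((k + 1 : ℕ) + 1)) * (1 + L ^ (k + 1 - 2)) := by
        have hk0 : (0 : ℝ) ≤ ((k + 1 : ℕ) : ℝ) := Nat.cast_nonneg _
        nlinarith

/-! ## §11. `W_j(M) = Σ_{m ≤ M} μ(m)/(mψ(m)) logʲ(M/m) = ζ(2)·j·log^{j−1}M + O_j(log^{j−2}M)` and the discharge -/

/-- `W_j(M) := Σ_{1 ≤ m ≤ M} μ(m) ψ(m)⁻¹ m⁻¹ logʲ(M/m)`. [folklore] -/
def weightLogPowSum (j : ℕ) (M : ℝ) : ℝ :=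
  ∑ m ∈ Finset.Icc 1 ⌊M⌋₊, W m * Real.log (M / m) ^ j

/-- Dirichlet's rearrangement: `W_j(M) = Σ_{n ≤ M} h(n) R_j(M/n)`. [folklore] -/
private theorem weightLogPowSum_eq (j : ℕ) (M : ℝ) :
    weightLogPowSum j M = ∑ n ∈ Finset.Icc 1 ⌊M⌋₊, Hh n * moebiusRiesz j (M / n) := by
  unfold weightLogPowSum moebiusRiesz
  rw [W_eq_G_mul_Hh, mul_comm G Hh]
  have hIcc : ∀ K : ℕ, Finset.Icc 1 K = Finset.Ioc 0 K := fun K ↦ by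
    ext m; simp [Finset.mem_Icc, Finset.mem_Ioc]; omega
  -- open the convolution and push the weight inside
  have h1 : ∑ m ∈ Finset.Icc 1 ⌊M⌋₊, (Hh * G) m * Real.log (M / m) ^ j =
      ∑ m ∈ Finset.Ioc 0 ⌊M⌋₊, ∑ x ∈ m.divisorsAntidiagonal,
        Hh x.1 * G x.2 * Real.log (M / (x.1 * x.2 : ℕ)) ^ j := by
    rw [hIcc]
    refine Finset.sum_congr rfl fun m _ ↦ ?_
    rw [mul_apply, Finset.sum_mul]
    refine Finset.sum_congr rfl fun x hx ↦ ?_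
    rw [(Nat.mem_divisorsAntidiagonal.1 hx).1]
  rw [h1, SiegelWalfiszLiouville.sum_Ioc_sum_divisorsAntidiagonal_eq
    (fun a b ↦ Hh a * G b * Real.log (M / (a * b : ℕ)) ^ j) ⌊M⌋₊, hIcc]
  refine Finset.sum_congr rfl fun n hn ↦ ?_
  have hn0 : (0 : ℝ) < n := by exact_mod_cast (Finset.mem_Ioc.1 hn).1
  rw [← Nat.floor_div_natCast, ← hIcc, Finset.mul_sum]
  refine Finset.sum_congr rfl fun d hd ↦ ?_
  have hd0 : (0 : ℝ) < d := by exact_mod_cast (Finset.mem_Icc.1 hd).1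
  rw [G_apply]
  push_cast
  rw [div_div, div_eq_mul_inv ((μ d : ℤ) : ℝ)]
  ring

/-- `1 < log 3`. [folklore] -/
private theorem one_lt_log_three : (1 : ℝ) < Real.log 3 := by
  rw [Real.lt_log_iff_exp_lt (by norm_num)]
  have := Real.exp_one_lt_d9
  linarith

/-- **`W_j(M) = (π²/6)·j·log^{j−1} M + O_j(log^{j−2} M)`** for `j ≥ 2`, `M ≥ 3` — the `k = 0`
residue computation of KMV §4.1 ((19)–(20): total residue `ζ(2)q̂^{1/2}P′(1)/log M` for
`P = xʲ`), done in real variables. [cite: KowalskiMichelVanderKam2000, §4.1 (19)–(20) (case k = 0)] -/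
theorem abs_weightLogPowSum_sub_le {j : ℕ} (hj : 2 ≤ j) :
    ∃ C : ℝ, ∀ M : ℝ, 3 ≤ M →
      |weightLogPowSum j M - π ^ 2 / 6 * j * Real.log M ^ (j - 1)| ≤ C * Real.log M ^ (j - 2) := by
  obtain ⟨A, hA⟩ := abs_moebiusRiesz_sub_le (show 1 ≤ j by omega)
  set H : ℝ := π ^ 2 / 6 with hH
  set H₁ : ℝ := ∑' n, Hh n * Real.log n with hH₁
  have hH₁0 : 0 ≤ H₁ := tsum_nonneg fun n ↦ by
    rcases Nat.eq_zero_or_pos n with rfl | hn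
    · simp
    · exact mul_nonneg (Hh_nonneg n) (Real.log_nonneg (by exact_mod_cast hn))
  have hA0 : 0 ≤ A := by
    have h := hA 1 le_rfl
    simp only [Real.log_one] at h
    have h0 : (0 : ℝ) ^ (j - 2) ≥ 0 := by positivity
    nlinarith [abs_nonneg (moebiusRiesz j 1 - ↑j * 0 ^ (j - 1))]
  refine ⟨|A| * H * 2 + j * (j - 1) * H₁ + j * H₁, fun M hM ↦ ?_⟩
  have hM0 : 0 < M := by linarith
  set L := Real.log M with hL
  have hL1 : 1 ≤ L := (one_lt_log_three.trans_le (Real.log_le_log (by norm_num) hM)).le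
  have hL0 : 0 < L := by linarith
  set N := ⌊M⌋₊ with hN
  have hN1 : 1 ≤ N := Nat.one_le_iff_ne_zero.2 (Nat.floor_pos.2 (by linarith)).ne'
  -- facts on the window `1 ≤ n ≤ N`
  have hlogn : ∀ n ∈ Finset.Icc 1 N, 0 ≤ Real.log (M / n) ∧ Real.log (M / n) ≤ L ∧
      L - Real.log (M / n) = Real.log n := by
    intro n hn
    obtain ⟨hn1, hnN⟩ := Finset.mem_Icc.1 hn
    have hn0 : (0 : ℝ) < n := by exact_mod_cast hn1
    have hnM : (n : ℝ) ≤ M := (show (n : ℝ) ≤ N by exact_mod_cast hnN).trans (Nat.floor_le hM0.le)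
    have hlog : Real.log (M / n) = L - Real.log n := by rw [hL, Real.log_div hM0.ne' hn0.ne']
    refine ⟨Real.log_nonneg ((one_le_div hn0).2 hnM), ?_, by rw [hlog]; ring⟩
    rw [hlog]
    linarith [Real.log_nonneg (show (1 : ℝ) ≤ n by exact_mod_cast hn1)]
  -- the partial sums of `h`
  have hsumH : ∑ n ∈ Finset.Icc 1 N, Hh n ≤ H :=
    sum_le_hasSum _ (fun n _ ↦ Hh_nonneg n) hasSum_Hh
  have hsumH₁ : ∑ n ∈ Finset.Icc 1 N, Hh n * Real.log n ≤ H₁ :=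
    sum_le_hasSum _ (fun n _ ↦ by
      rcases Nat.eq_zero_or_pos n with rfl | hn
      · simp
      · exact mul_nonneg (Hh_nonneg n) (Real.log_nonneg (by exact_mod_cast hn)))
      summable_Hh_mul_log.hasSum
  -- the tail `H − Σ_{n ≤ N} h(n) ≤ H₁ / L`
  have htail : H - ∑ n ∈ Finset.Icc 1 N, Hh n ≤ H₁ / L := by
    have hIcc : ∑ n ∈ Finset.Icc 1 N, Hh n = ∑ n ∈ Finset.range (N + 1), Hh n := by
      rw [Finset.range_eq_Ico]
      have : Finset.Ico 0 (N + 1) = insert 0 (Finset.Icc 1 N) := by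
        ext n; simp [Finset.mem_Icc]; omega
      rw [this, Finset.sum_insert (by simp)]
      simp
    have hIcc₁ : ∑ n ∈ Finset.Icc 1 N, Hh n * Real.log n =
        ∑ n ∈ Finset.range (N + 1), Hh n * Real.log n := by
      rw [Finset.range_eq_Ico]
      have : Finset.Ico 0 (N + 1) = insert 0 (Finset.Icc 1 N) := by
        ext n; simp [Finset.mem_Icc]; omega
      rw [this, Finset.sum_insert (by simp)]
      simp
    have ht := summable_Hh.sum_add_tsum_nat_add (N + 1)
    have ht₁ := summable_Hh_mul_log.sum_add_tsum_nat_add (N + 1)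
    rw [hasSum_Hh.tsum_eq] at ht
    rw [hIcc]
    -- termwise: `h(i+N+1) ≤ h(i+N+1) log(i+N+1) / L`
    have hterm : ∀ i : ℕ, Hh (i + (N + 1)) ≤ Hh (i + (N + 1)) * Real.log ((i + (N + 1) : ℕ) : ℝ) / L := by
      intro i
      have hgt : M < ((i + (N + 1) : ℕ) : ℝ) := by
        push_cast
        have := Nat.lt_floor_add_one M
        rw [← hN] at this
        have hi : (0 : ℝ) ≤ i := Nat.cast_nonneg i
        linarith
      have hlog : L ≤ Real.log ((i + (N + 1) : ℕ) : ℝ) := Real.log_le_log hM0 hgt.le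
      rw [le_div_iff₀ hL0]
      exact mul_le_mul_of_nonneg_left hlog (Hh_nonneg _)
    have htail' : ∑' i, Hh (i + (N + 1)) ≤ (∑' i, Hh (i + (N + 1)) * Real.log ((i + (N + 1) : ℕ) : ℝ)) / L := by
      rw [← tsum_div_const]
      exact Summable.tsum_le_tsum hterm ((summable_nat_add_iff (N + 1)).2 summable_Hh)
        (((summable_nat_add_iff (N + 1)).2 summable_Hh_mul_log).div_const _)
    have hnn : 0 ≤ ∑ n ∈ Finset.range (N + 1), Hh n * Real.log n := by
      rw [← hIcc₁]
      exact Finset.sum_nonneg fun n hn ↦ mul_nonneg (Hh_nonneg n)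
        (Real.log_nonneg (by exact_mod_cast (Finset.mem_Icc.1 hn).1))
    have : ∑' i, Hh (i + (N + 1)) * Real.log ((i + (N + 1) : ℕ) : ℝ) ≤ H₁ := by
      rw [hH₁, ← ht₁]; linarith
    calc H - ∑ n ∈ Finset.range (N + 1), Hh n = ∑' i, Hh (i + (N + 1)) := by linarith
      _ ≤ H₁ / L := htail'.trans (div_le_div_of_nonneg_right this hL0.le)
  have htail0 : 0 ≤ H - ∑ n ∈ Finset.Icc 1 N, Hh n := by linarith
  -- decomposition of the difference
  rw [weightLogPowSum_eq]
  have hdec : ∑ n ∈ Finset.Icc 1 N, Hh n * moebiusRiesz j (M / n) - H * j * L ^ (j - 1) =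
      ∑ n ∈ Finset.Icc 1 N, Hh n * (moebiusRiesz j (M / n) - j * Real.log (M / n) ^ (j - 1)) +
      j * ∑ n ∈ Finset.Icc 1 N, Hh n * (Real.log (M / n) ^ (j - 1) - L ^ (j - 1)) -
      j * L ^ (j - 1) * (H - ∑ n ∈ Finset.Icc 1 N, Hh n) := by
    have : ∑ n ∈ Finset.Icc 1 N, Hh n * moebiusRiesz j (M / n) =
        ∑ n ∈ Finset.Icc 1 N, (Hh n * (moebiusRiesz j (M / ↑n) - j * Real.log (M / n) ^ (j - 1)) +
          j * (Hh n * (Real.log (M / n) ^ (j - 1) - L ^ (j - 1))) + j * L ^ (j - 1) * Hh n) := by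
      refine Finset.sum_congr rfl fun n _ ↦ ?_; ring
    rw [this, Finset.sum_add_distrib, Finset.sum_add_distrib, ← Finset.mul_sum, ← Finset.mul_sum]
    ring
  rw [hdec]
  -- term 1
  have h1 : |∑ n ∈ Finset.Icc 1 N, Hh n * (moebiusRiesz j (M / n) - j * Real.log (M / n) ^ (j - 1))|
      ≤ |A| * H * 2 * L ^ (j - 2) := by
    refine (Finset.abs_sum_le_sum_abs _ _).trans ?_
    have hb : ∀ n ∈ Finset.Icc 1 N, |Hh n * (moebiusRiesz j (M / n) - j * Real.log (M / n) ^ (j - 1))|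
        ≤ Hh n * (|A| * (2 * L ^ (j - 2))) := by
      intro n hn
      obtain ⟨hl0, hlL, -⟩ := hlogn n hn
      have hn0 : (0 : ℝ) < n := by exact_mod_cast (Finset.mem_Icc.1 hn).1
      have hMn : 1 ≤ M / n := by
        rw [one_le_div hn0]
        exact (show (n : ℝ) ≤ N by exact_mod_cast (Finset.mem_Icc.1 hn).2).trans (Nat.floor_le hM0.le)
      rw [abs_mul, abs_of_nonneg (Hh_nonneg n)]
      refine mul_le_mul_of_nonneg_left ((hA _ hMn).trans ?_) (Hh_nonneg n)
      have hp : Real.log (M / n) ^ (j - 2) ≤ L ^ (j - 2) := pow_le_pow_left₀ hl0 hlL _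
      have hL2 : 1 ≤ L ^ (j - 2) := one_le_pow₀ hL1
      calc A * (1 + Real.log (M / n) ^ (j - 2)) ≤ |A| * (1 + Real.log (M / n) ^ (j - 2)) :=
            mul_le_mul_of_nonneg_right (le_abs_self A) (by positivity)
        _ ≤ |A| * (2 * L ^ (j - 2)) := mul_le_mul_of_nonneg_left (by linarith) (abs_nonneg A)
    refine (Finset.sum_le_sum hb).trans ?_
    rw [← Finset.sum_mul]
    calc (∑ n ∈ Finset.Icc 1 N, Hh n) * (|A| * (2 * L ^ (j - 2))) ≤ H * (|A| * (2 * L ^ (j - 2))) :=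
          mul_le_mul_of_nonneg_right hsumH (by positivity)
      _ = |A| * H * 2 * L ^ (j - 2) := by ring
  -- term 2
  have h2 : |(j : ℝ) * ∑ n ∈ Finset.Icc 1 N, Hh n * (Real.log (M / n) ^ (j - 1) - L ^ (j - 1))|
      ≤ j * (j - 1) * H₁ * L ^ (j - 2) := by
    rw [abs_mul, abs_of_nonneg (Nat.cast_nonneg j)]
    have hb : ∀ n ∈ Finset.Icc 1 N, |Hh n * (Real.log (M / n) ^ (j - 1) - L ^ (j - 1))| ≤
        (j - 1) * L ^ (j - 2) * (Hh n * Real.log n) := by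
      intro n hn
      obtain ⟨hl0, hlL, hdiff⟩ := hlogn n hn
      have hp := pow_sub_pow_le hl0 hlL (j - 1)
      rw [hdiff, show j - 1 - 1 = j - 2 by omega] at hp
      rw [abs_mul, abs_of_nonneg (Hh_nonneg n), abs_sub_comm,
        abs_of_nonneg (sub_nonneg.2 (pow_le_pow_left₀ hl0 hlL _))]
      have hj1 : (((j - 1 : ℕ)) : ℝ) = (j : ℝ) - 1 := by
        rw [Nat.cast_sub (by omega)]; simp
      rw [hj1] at hp
      calc Hh n * (L ^ (j - 1) - Real.log (M / n) ^ (j - 1))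
          ≤ Hh n * (((j : ℝ) - 1) * L ^ (j - 2) * Real.log n) := mul_le_mul_of_nonneg_left hp (Hh_nonneg n)
        _ = ((j : ℝ) - 1) * L ^ (j - 2) * (Hh n * Real.log n) := by ring
    calc (j : ℝ) * |∑ n ∈ Finset.Icc 1 N, Hh n * (Real.log (M / n) ^ (j - 1) - L ^ (j - 1))|
        ≤ j * ∑ n ∈ Finset.Icc 1 N, (j - 1) * L ^ (j - 2) * (Hh n * Real.log n) :=
          mul_le_mul_of_nonneg_left ((Finset.abs_sum_le_sum_abs _ _).trans (Finset.sum_le_sum hb))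
            (Nat.cast_nonneg j)
      _ = j * ((j - 1) * L ^ (j - 2) * ∑ n ∈ Finset.Icc 1 N, Hh n * Real.log n) := by
          rw [Finset.mul_sum, Finset.mul_sum, Finset.mul_sum]
      _ ≤ j * ((j - 1) * L ^ (j - 2) * H₁) := by
          have hj1 : (0 : ℝ) ≤ (j : ℝ) - 1 := by
            have : (2 : ℝ) ≤ j := by exact_mod_cast hj
            linarith
          gcongr
      _ = j * (j - 1) * H₁ * L ^ (j - 2) := by ring
  -- term 3
  have h3 : |(j : ℝ) * L ^ (j - 1) * (H - ∑ n ∈ Finset.Icc 1 N, Hh n)| ≤ j * H₁ * L ^ (j - 2) := by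
    rw [abs_of_nonneg (by positivity)]
    have hLpow : L ^ (j - 1) = L ^ (j - 2) * L := by
      rw [← pow_succ, show j - 2 + 1 = j - 1 by omega]
    calc (j : ℝ) * L ^ (j - 1) * (H - ∑ n ∈ Finset.Icc 1 N, Hh n)
        ≤ j * L ^ (j - 1) * (H₁ / L) := mul_le_mul_of_nonneg_left htail (by positivity)
      _ = j * H₁ * L ^ (j - 2) := by rw [hLpow]; field_simp
  calc |∑ n ∈ Finset.Icc 1 N, Hh n * (moebiusRiesz j (M / n) - j * Real.log (M / n) ^ (j - 1)) +
        j * ∑ n ∈ Finset.Icc 1 N, Hh n * (Real.log (M / n) ^ (j - 1) - L ^ (j - 1)) -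
        j * L ^ (j - 1) * (H - ∑ n ∈ Finset.Icc 1 N, Hh n)|
      ≤ |∑ n ∈ Finset.Icc 1 N, Hh n * (moebiusRiesz j (M / n) - j * Real.log (M / n) ^ (j - 1))| +
        |(j : ℝ) * ∑ n ∈ Finset.Icc 1 N, Hh n * (Real.log (M / n) ^ (j - 1) - L ^ (j - 1))| +
        |(j : ℝ) * L ^ (j - 1) * (H - ∑ n ∈ Finset.Icc 1 N, Hh n)| := by
          exact (abs_sub _ _).trans (add_le_add (abs_add_le _ _) le_rfl)
    _ ≤ |A| * H * 2 * L ^ (j - 2) + j * (j - 1) * H₁ * L ^ (j - 2) + j * H₁ * L ^ (j - 2) :=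
        add_le_add (add_le_add h1 h2) h3
    _ = (|A| * H * 2 + j * (j - 1) * H₁ + j * H₁) * L ^ (j - 2) := by ring

end MollifierMainTerm

/-! ## §12. The discharge: `MollifierMainTermAsymp P` for every admissible `P`, and S1 from Bettin alone -/

open MollifierMainTerm

/-- `S_P(M) = Σ_i a_i (log M)^{−i} W_i(M)` for `P = Σ a_i Xⁱ`. [folklore] -/
private theorem mollifierMainSum_eq_sum_coeff (P : ℝ[X]) (M : ℝ) :
    mollifierMainSum P M = ∑ i ∈ Finset.range (P.natDegree + 1),
      P.coeff i * (Real.log M)⁻¹ ^ i * weightLogPowSum i M := by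
  unfold mollifierMainSum weightLogPowSum
  have hm : ∀ m ∈ Finset.Icc 1 ⌊M⌋₊,
      (μ m : ℝ) * ((psi m)⁻¹ * (m : ℝ)⁻¹ * P.eval (Real.log (M / m) / Real.log M)) =
        ∑ i ∈ Finset.range (P.natDegree + 1),
          P.coeff i * (Real.log M)⁻¹ ^ i * (W m * Real.log (M / m) ^ i) := by
    intro m hm
    have hm0 : m ≠ 0 := by have := (Finset.mem_Icc.1 hm).1; omega
    have hW := W_apply hm0
    rw [Polynomial.eval_eq_sum_range]
    simp only [Finset.mul_sum]
    refine Finset.sum_congr rfl fun i _ ↦ ?_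
    rw [hW, div_eq_mul_inv, mul_pow]
    ring
  rw [Finset.sum_congr rfl hm, Finset.sum_comm]
  refine Finset.sum_congr rfl fun i _ ↦ ?_
  rw [Finset.mul_sum]

/-- **The diagonal main term, discharged: `S_P(M) = ζ(2)P′(1)/log M + O_P(log⁻² M)` for every
admissible `P`** (`P(0) = P′(0) = 0`): KMV's first-moment main term at `k = 0` (§4.1 (20)), here
PROVED from the prime number theorem for `μ` in the tree (`MoebiusHarmonicSumBound`,
`MoebiusLogHarmonicSum`, `GreenTao2008MoebiusLogSum`).
[cite: KowalskiMichelVanderKam2000, §4.1 (19)–(20) and Prop. 4.1 (case k = 0)] -/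
theorem mollifierMainTermAsymp_of_admissible {P : ℝ[X]} (hP : Admissible P) :
    MollifierMainTermAsymp P := by
  classical
  -- constants for `2 ≤ i ≤ deg P`
  have hC : ∀ i : ℕ, ∃ C : ℝ, 0 ≤ C ∧ (2 ≤ i → ∀ M : ℝ, 3 ≤ M →
      |weightLogPowSum i M - π ^ 2 / 6 * i * Real.log M ^ (i - 1)| ≤ C * Real.log M ^ (i - 2)) := by
    intro i
    by_cases hi : 2 ≤ i
    · obtain ⟨C, hC⟩ := abs_weightLogPowSum_sub_le hi
      refine ⟨max C 0, le_max_right _ _, fun _ M hM ↦ (hC M hM).trans ?_⟩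
      exact mul_le_mul_of_nonneg_right (le_max_left _ _)
        (pow_nonneg ((one_lt_log_three.trans_le (Real.log_le_log (by norm_num) hM)).le.trans' zero_le_one) _)
    · exact ⟨0, le_rfl, fun h ↦ absurd h hi⟩
  choose C hC0 hC using hC
  refine ⟨∑ i ∈ Finset.range (P.natDegree + 1), |P.coeff i| * C i, 3, fun M hM ↦ ?_⟩
  have hM0 : 0 < M := by linarith
  set L := Real.log M with hL
  have hL1 : 1 ≤ L := (one_lt_log_three.trans_le (Real.log_le_log (by norm_num) hM)).le
  have hL0 : 0 < L := by linarith
  -- `a₀ = a₁ = 0`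
  have ha0 : P.coeff 0 = 0 := by rw [Polynomial.coeff_zero_eq_eval_zero]; exact hP.1
  have ha1 : P.coeff 1 = 0 := by
    have h := hP.2
    rw [← Polynomial.coeff_zero_eq_eval_zero, Polynomial.coeff_derivative] at h
    simpa using h
  -- `P′(1) = Σ i a_i`
  have hderiv : (derivative P).eval 1 = ∑ i ∈ Finset.range (P.natDegree + 1), P.coeff i * i := by
    rw [Polynomial.derivative_eval, Polynomial.sum_over_range _ (fun n ↦ by simp)]
    simp
  rw [mollifierMainSum_eq_sum_coeff, hderiv]
  have hre : ∑ i ∈ Finset.range (P.natDegree + 1), P.coeff i * L⁻¹ ^ i * weightLogPowSum i M -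
      π ^ 2 / 6 * (∑ i ∈ Finset.range (P.natDegree + 1), P.coeff i * i) / L =
      ∑ i ∈ Finset.range (P.natDegree + 1),
        P.coeff i * (L⁻¹ ^ i * weightLogPowSum i M - π ^ 2 / 6 * i / L) := by
    rw [mul_div_assoc, Finset.sum_div, Finset.mul_sum, ← Finset.sum_sub_distrib]
    refine Finset.sum_congr rfl fun i _ ↦ ?_
    ring
  rw [hre]
  refine (Finset.abs_sum_le_sum_abs _ _).trans ?_
  rw [Finset.sum_div]
  refine Finset.sum_le_sum fun i hi ↦ ?_
  rcases lt_or_ge i 2 with hi2 | hi2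
  · -- `i = 0, 1`: the coefficient vanishes
    have : P.coeff i = 0 := by interval_cases i <;> assumption
    simp [this]
  · have hLi1 : L ^ i = L ^ (i - 1) * L := by rw [← pow_succ, Nat.sub_add_cancel (by omega)]
    have hLi2 : L ^ i = L ^ (i - 2) * L ^ 2 := by rw [← pow_add, Nat.sub_add_cancel hi2]
    have hLi0 : L ^ i ≠ 0 := pow_ne_zero _ hL0.ne'
    have e1 : L⁻¹ ^ i * weightLogPowSum i M - π ^ 2 / 6 * i / L =
        L⁻¹ ^ i * (weightLogPowSum i M - π ^ 2 / 6 * i * L ^ (i - 1)) := by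
      rw [inv_pow, mul_sub]
      congr 1
      rw [eq_comm, inv_mul_eq_div, div_eq_div_iff hLi0 hL0.ne', hLi1]
      ring
    rw [e1, abs_mul, abs_mul, abs_of_nonneg (by positivity : (0 : ℝ) ≤ L⁻¹ ^ i)]
    calc |P.coeff i| * (L⁻¹ ^ i * |weightLogPowSum i M - π ^ 2 / 6 * i * L ^ (i - 1)|)
        ≤ |P.coeff i| * (L⁻¹ ^ i * (C i * L ^ (i - 2))) :=
          mul_le_mul_of_nonneg_left (mul_le_mul_of_nonneg_left (hC i hi2 M hM) (by positivity))
            (abs_nonneg _)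
      _ = |P.coeff i| * C i / L ^ 2 := by
          rw [inv_pow, hLi2]
          field_simp

/-- **S1 from Bettin's theorem ALONE** (corrected binder `Δ' < min Δ 2`): for every window
`(1, Δ]` and every MA-consistent `(T₁, T₂)`, the first correction of the profile `X²` at `Q = 1`
vanishes on `(1, min Δ 2)`. [cite: Bettin2017, Thm. 1.1]
[cite: KowalskiMichelVanderKam2000, Prop. 4.1 and §6 p. 19] -/
theorem firstCorrectionVanishes_of_bettin_X_sq (hB : bettin2017_theorem11_primeLevel) :
    ∀ Δ : ℝ, 1 < Δ → ∀ T₁ T₂ : ℝ → ℝ[X] → ℝ[X] → ℝ, MomentAsymptotics 1 Δ T₁ T₂ →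
      ∀ Δ' : ℝ, 1 < Δ' → Δ' < min Δ 2 → T₁ Δ' (X ^ 2) 1 = 0 :=
  firstCorrectionVanishes_of_bettin hB (mollifierMainTermAsymp_of_admissible admissible_X_sq)

/-- The same for every admissible profile. [cite: Bettin2017, Thm. 1.1]
[cite: KowalskiMichelVanderKam2000, Prop. 4.1 and §6 p. 19] -/
theorem T₁_apply_one_eq_zero_of_bettin (hB : bettin2017_theorem11_primeLevel) {P : ℝ[X]}
    (hP : Admissible P) {Δ : ℝ} {T₁ T₂ : ℝ → ℝ[X] → ℝ[X] → ℝ}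
    (hMA : MomentAsymptotics 1 Δ T₁ T₂) {Δ' : ℝ} (h1 : 1 < Δ') (h2 : Δ' < min Δ 2) :
    T₁ Δ' P 1 = 0 :=
  T₁_apply_one_eq_zero hB hP (mollifierMainTermAsymp_of_admissible hP) hMA h1 h2

/-- The first KMV display with zero extra main term at `Q = 1` on `0 < Δ' < 2`, from Bettin's
/-- Helper. [folklore] -/
theorem alone (the K_A-side consolidation at `Q = 1`). [cite: Bettin2017, Thm. 1.1]
[cite: KowalskiMichelVanderKam2000, Prop. 4.1 (case k = 0)] -/
theorem firstDisplay_of_bettin' (hB : bettin2017_theorem11_primeLevel) {P : ℝ[X]}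
    (hP : Admissible P) {Δ : ℝ} (hΔ0 : 0 < Δ) (hΔ2 : Δ < 2) :
    ∃ C : ℝ, ∃ q₀ : ℕ, ∀ (q : ℕ) [NeZero q], q.Prime → q₀ ≤ q →
      ‖LhPQ q P 1 (qhat q ^ Δ) -
          ((riemannZeta 2 * ((Real.sqrt (qhat q) / (Δ * Real.log (qhat q)) : ℝ) : ℂ)) *
            ((KMV2000.linForm Δ P 1 + 0 : ℝ) : ℂ))‖ ≤
        C * Real.sqrt (qhat q) * (Real.log (qhat q))⁻¹ ^ 2 :=
  firstDisplay_of_bettin hB (mollifierMainTermAsymp_of_admissible hP) hΔ0 hΔ2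

end KMV2000

end Literature.NumberTheory.LFunctions
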